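import Literature.NumberTheory.EllipticCurves.HeegnerGeomStabilizedPointIdentitiesProofs
import HarnessLib

/-!
# CGLS's shifted norm points `u_k`, `v_k` lie, up to a `p`-adic unit and ONE `K_δ`-rational point, in the
# `ℤ`-span of Howard's generators `z_{δ+1}, …, z_k` (the reverse triangular solve of the Heegner-module
# envelope; CGLS 2022 Rem. 4.1.4 / Howard 2004 §3.3 / Perrin-Riou 1987 §3.4) — THEOREMS ONLY

Topic `NumberTheory/EllipticCurves`; namespace `Literature.NumberTheory.EllipticCurves`. No definition, no named
fact, no `sorry`. Cell `pub/bsd-print-x9`, seat `bsd-line-x9-p1-w2` (stub worker; the «packaging» the lead asked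
for, 2026-08-28T08:51Z, of the point identities of `HeegnerGeomStabilizedPointIdentitiesProofs` for the REVERSE
envelope `ω • Λκ_∞(C) ≤ ℋ_∞(F)` of the crux `PrintX9.HowardContainmentLightFramePinnedOfPrint[Sharp]`).

SETTING (the letter of the `∃`-outputs of `exists_stabilizedHeegnerData_of_system` /
`exists_heegnerFamily_of_system`, NO pin on the shifts): a system `x_j ∈ E(K̄)` over `φ(x(p^j))` with models,
`x_j` fixed by `Gal(K̄/K[p^j])`; a `ℤ_p`-extension `κ`; a depth `δ`; shifts `d(k)` with, for `k > δ`,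
`2 ≤ d(k)`, `Gal(K̄/K[p^{d(k)}]) ≤ Gal(K̄/K_k)` and minimality `¬ Gal(K̄/K[p^{d'}]) ≤ Gal(K̄/K_k)` for `d' < d(k)`;
transversals `A_k` of `Gal(K̄/K[p^{d(k)}])` in `Gal(K̄/K_k)` and `R_k` of `Gal(K̄/K[p^{k+1}])` in `Gal(K̄/K_k)`;
`u_k = ∑_{A_k} a • x_{d(k)}`, `v_k = ∑_{A_k} a • x_{d(k)−1}`, `z_k = ∑_{R_k} r • x_{k+1}`; `p ∤ a_p` (ordinary).

* `exists_int_not_dvd_smul_mem_span_of_shifted` — for every `k > δ` there is `M ∈ ℤ`, `p ∤ M`, with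
  `M • u_k` and `M • v_k` in `ℤ·v_{δ+1} + Σ_{δ<j≤k} ℤ·z_j` (induction on `k`: (P3) `z_k = A_e u_k + B_e v_k`
  with `p ∤ A_e`, (P1′) `v_{k+1} = A_n u_k + B_n v_k`; pivots `A_e`);
* `smul_shifted_pred_depth_succ_eq` — the extra point `v_{δ+1}` is fixed by `Gal(K̄/K_δ)` ((P1″) at `k = δ`), so
  `γ^{p^δ} − 1` kills its Kummer classes: this is why the reverse envelope holds with the multiplier
  `ω_δ = (1+T)^{p^δ} − 1` and NO bottom (Cassini-type) relation.
HONEST FRAMING: Galois bookkeeping plus the cited CM relations; nothing on `L`-functions, Selmer groups or BSD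
is asserted; BSD is not proved by any of this.

References: [CastellaGrossiLeeSkinner2022] Thm. 4.1.1 proof, Rem. 4.1.4 (arXiv:2008.02571v2 p. 22);
[Howard2004HeegnerKolyvagin] §3.3 (Thm. 3.3.7: the classes generate `lim H_k`); [PerrinRiou1987BSMF] §3.4 Prop. 10.
-/

set_option autoImplicit false

noncomputable section

open scoped Classical

namespace Literature.NumberTheory.EllipticCurves

open WeierstrassCurve RingClassField

variable {K : Type} [Field K] [NumberField K]

/-- Integer solutions of `X_{n+2} = a X_{n+1} − q X_n` with given `X₀, X₁` (private plumbing). [folklore] -/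
private theorem exists_lucas_seq' (a q x₀ x₁ : ℤ) :
    ∃ X : ℕ → ℤ, X 0 = x₀ ∧ X 1 = x₁ ∧ ∀ n, X (n + 2) = a * X (n + 1) - q * X n := by
  let F : ℕ → ℤ × ℤ := fun n ↦ Nat.rec (x₀, x₁) (fun _ y ↦ (y.2, a * y.2 - q * y.1)) n
  have hF : ∀ n, F (n + 1) = ((F n).2, a * (F n).2 - q * (F n).1) := fun n ↦ rfl
  refine ⟨fun n ↦ (F n).1, rfl, ?_, fun n ↦ ?_⟩
  · show (F (0 + 1)).1 = x₁
    rw [hF 0]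
    rfl
  · show (F (n + 1 + 1)).1 = a * (F (n + 1)).1 - q * (F n).1
    rw [hF (n + 1), hF n]

section Packaging

variable {W : WeierstrassCurve ℚ} [W.IsElliptic] [W.IsGloballyMinimal] [NeZero (W.conductorNorm ℤ)]
  (hK : IsImaginaryQuadratic K) (hH : SatisfiesHeegnerHypothesis (W.conductorNorm ℤ) K)
  (Dt : ModularForms.ModularParametrizationData W (W.conductorNorm ℤ)) {β : ℤ}
  (hβ : (4 * (W.conductorNorm ℤ : ℕ) : ℤ) ∣ β ^ 2 - NumberField.discr K)
  (jbar : AlgebraicClosure K →+* ℂ) {p : ℕ} [Fact p.Prime] (hpN : ¬ p ∣ W.conductorNorm ℤ)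
  (hap : ¬ (p : ℤ) ∣ W.frobeniusTrace p)
  {x : ℕ → WeierstrassCurve.geomPoints (W.baseChange K)}
  {P : ∀ j : ℕ,
    (W.baseChange (ringClassField K (jbar.comp (algebraMap K (AlgebraicClosure K))) (p ^ j))).toAffine.Point}
  (hx : ∀ j, complexPoint W jbar (x j) =
    ModularForms.heegnerPointComplexOfConductor Dt (NumberField.discr K) β (p ^ j))
  (hP : ∀ j, WeierstrassCurve.Affine.Point.map (W' := W)
    (ringClassField K (jbar.comp (algebraMap K (AlgebraicClosure K))) (p ^ j)).subtype.toRatAlgHom (P j) =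
    ModularForms.heegnerPointComplexOfConductor Dt (NumberField.discr K) β (p ^ j))
  (hfix : ∀ j, ∀ σ ∈ ringClassSubgroup K (p ^ j) jbar, σ • x j = x j)
  (κ : ZpExtension K p) (δ : ℕ) (d : ℕ → ℕ)
  (htwo : ∀ k, δ < k → 2 ≤ d k) (hdk : ∀ k, δ < k → d k ≤ k + 1)
  (hle : ∀ k, δ < k → ringClassSubgroup K (p ^ d k) jbar ≤ κ.layerSubgroup k)
  (hmin : ∀ k d', δ < k → d' < d k → ¬ ringClassSubgroup K (p ^ d') jbar ≤ κ.layerSubgroup k)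
  (A : ℕ → Finset (Field.absoluteGaloisGroup K)) (hA : ∀ k, ∀ a ∈ A k, a ∈ κ.layerSubgroup k)
  (htA : ∀ k, ∀ τ ∈ κ.layerSubgroup k, ∃! a, a ∈ A k ∧ a⁻¹ * τ ∈ ringClassSubgroup K (p ^ d k) jbar)
  (R : ℕ → Finset (Field.absoluteGaloisGroup K)) (hR : ∀ k, ∀ r ∈ R k, r ∈ κ.layerSubgroup k)
  (htR : ∀ k, ∀ τ ∈ κ.layerSubgroup k, ∃! r, r ∈ R k ∧ r⁻¹ * τ ∈ ringClassSubgroup K (p ^ (k + 1)) jbar)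

include hK hH hβ hpN hap hx hP hfix htwo hdk hle hmin hA htA hR htR

/-- **The reverse triangular solve, packaged**: for every layer `k > δ` there is an integer `M` prime to `p`
such that `M • u_k` and `M • v_k` lie in the `ℤ`-span of `v_{δ+1}` and of Howard's `z_j`, `δ < j ≤ k`
(`u_k = ∑_{A_k} a • x_{d(k)}`, `v_k = ∑_{A_k} a • x_{d(k)−1}`, `z_j = ∑_{R_j} r • x_{j+1}`). Induction on `k`:
`z_k = A_e • u_k + B_e • v_k` with `p ∤ A_e` ((P3), `not_dvd_lucas_of_not_dvd`) and
`v_{k+1} = A_n • u_k + B_n • v_k` ((P1′), the shift dropping by at least one per layer,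
`ringClassSubgroup_pred_le_layerSubgroup` + minimality). NO pin on `d`, NO bottom relation.
[cite: Howard2004HeegnerKolyvagin, §3.3, Thm. 3.3.7] [cite: CastellaGrossiLeeSkinner2022, Rem. 4.1.4] [cite: PerrinRiou1987BSMF, §3.4 Prop. 10] -/
theorem exists_int_not_dvd_smul_mem_span_of_shifted (k : ℕ) (hk : δ < k) :
    ∃ M : ℤ, ¬ (p : ℤ) ∣ M ∧
      M • (∑ a ∈ A k, a • x (d k)) ∈ Submodule.span ℤ
        (insert (∑ a ∈ A (δ + 1), a • x (d (δ + 1) - 1))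
          ((fun j ↦ ∑ r ∈ R j, r • x (j + 1)) '' Set.Ioc δ k)) ∧
      M • (∑ a ∈ A k, a • x (d k - 1)) ∈ Submodule.span ℤ
        (insert (∑ a ∈ A (δ + 1), a • x (d (δ + 1) - 1))
          ((fun j ↦ ∑ r ∈ R j, r • x (j + 1)) '' Set.Ioc δ k)) := by
  have hp : p.Prime := Fact.out
  obtain ⟨La, hA0, hA1, hLa⟩ := exists_lucas_seq' (W.frobeniusTrace p) p 1 (W.frobeniusTrace p)
  obtain ⟨Lb, hB0, hB1, hLb⟩ := exists_lucas_seq' (W.frobeniusTrace p) p 0 (-1)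
  have hLa_unit : ∀ n, ¬ (p : ℤ) ∣ La n := not_dvd_lucas_of_not_dvd hap La hA0 hA1 hLa hp
  -- notation-free abbreviations
  set w := ∑ a ∈ A (δ + 1), a • x (d (δ + 1) - 1) with hw
  -- the spans are monotone in `k`
  have hmono : ∀ {k k' : ℕ}, k ≤ k' →
      Submodule.span ℤ (insert w ((fun j ↦ ∑ r ∈ R j, r • x (j + 1)) '' Set.Ioc δ k)) ≤
        Submodule.span ℤ (insert w ((fun j ↦ ∑ r ∈ R j, r • x (j + 1)) '' Set.Ioc δ k')) :=
    fun hkk' ↦ Submodule.span_mono (Set.insert_subset_insert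
      (Set.image_mono (Set.Ioc_subset_Ioc_right hkk')))
  -- `z_j` and `w` are in the span
  have hz : ∀ {k j : ℕ}, δ < j → j ≤ k → ∑ r ∈ R j, r • x (j + 1) ∈
      Submodule.span ℤ (insert w ((fun j ↦ ∑ r ∈ R j, r • x (j + 1)) '' Set.Ioc δ k)) :=
    fun hj hjk ↦ Submodule.subset_span (Set.mem_insert_of_mem _ ⟨_, ⟨hj, hjk⟩, rfl⟩)
  have hwmem : ∀ k : ℕ, w ∈ Submodule.span ℤ (insert w ((fun j ↦ ∑ r ∈ R j, r • x (j + 1)) '' Set.Ioc δ k)) :=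
    fun k ↦ Submodule.subset_span (Set.mem_insert _ _)
  -- (P3) at a layer `j > δ`
  have hP3 : ∀ j, δ < j → ∑ r ∈ R j, r • x (j + 1) =
      La (j + 1 - d j) • ∑ a ∈ A j, a • x (d j) + Lb (j + 1 - d j) • ∑ a ∈ A j, a • x (d j - 1) :=
    fun j hj ↦ sum_transversal_smul_eq_lucas_of_layer hK hH Dt hβ jbar hpN hx hP hfix κ La Lb hA0 hA1 hLa
      hB0 hB1 hLb (by have := htwo j hj; omega) (hdk j hj) (hle j hj) (hA j) (htA j) (hR j) (htR j)
  -- induction on `k`, starting at `δ + 1`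
  induction k with
  | zero => exact absurd hk (Nat.not_lt_zero _)
  | succ k ih =>
    rcases Nat.lt_succ_iff_lt_or_eq.mp hk with hlt | heq
    · -- step `k → k + 1`, `k > δ`
      obtain ⟨M, hM, hu, hv⟩ := ih hlt
      -- the shift drops: `d k ≤ d (k+1) - 1`
      have hnot : ¬ ringClassSubgroup K (p ^ (d (k + 1) - 1)) jbar ≤ κ.layerSubgroup (k + 1) :=
        hmin (k + 1) _ hk (by have := htwo (k + 1) hk; omega)
      have hdrop : d k ≤ d (k + 1) - 1 := by
        by_contra hcon
        exact hmin k (d (k + 1) - 1) hlt (by omega)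
          (ringClassSubgroup_pred_le_layerSubgroup hK jbar κ (htwo (k + 1) hk) (hle (k + 1) hk) hnot)
      -- (P1′): `v_{k+1} = A_n u_k + B_n v_k`
      have hP1 := sum_transversal_smul_pred_eq_lucas_of_layer_succ hK hH Dt hβ jbar hpN hx hP hfix κ La Lb
        hA0 hA1 hLa hB0 hB1 hLb (htwo (k + 1) hk) (hle (k + 1) hk) hnot (hA (k + 1)) (htA (k + 1))
        (by have := htwo k hlt; omega) hdrop (hle k hlt) (hA k) (htA k)
      have hv' : M • ∑ a ∈ A (k + 1), a • x (d (k + 1) - 1) ∈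
          Submodule.span ℤ (insert w ((fun j ↦ ∑ r ∈ R j, r • x (j + 1)) '' Set.Ioc δ (k + 1))) := by
        rw [hP1, smul_add, smul_comm M (La _), smul_comm M (Lb _)]
        exact Submodule.add_mem _ (Submodule.smul_mem _ _ (hmono (Nat.le_succ k) hu))
          (Submodule.smul_mem _ _ (hmono (Nat.le_succ k) hv))
      refine ⟨La (k + 1 + 1 - d (k + 1)) * M, ?_, ?_, ?_⟩
      · exact fun h ↦ ((Int.prime_iff_natAbs_prime.mpr (by simpa using hp)).dvd_or_dvd h).elim
          (hLa_unit _) hM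
      · -- `A_e M • u_{k+1} = M • z_{k+1} − B_e • (M • v_{k+1})`
        have h3 := hP3 (k + 1) hk
        have key : (La (k + 1 + 1 - d (k + 1)) * M) • ∑ a ∈ A (k + 1), a • x (d (k + 1)) =
            M • ∑ r ∈ R (k + 1), r • x (k + 1 + 1) -
              Lb (k + 1 + 1 - d (k + 1)) • (M • ∑ a ∈ A (k + 1), a • x (d (k + 1) - 1)) := by
          rw [h3, smul_add, mul_smul, smul_comm M (La _), smul_comm M (Lb _)]
          abel
        rw [key]
        exact Submodule.sub_mem _ (Submodule.smul_mem _ _ (hz hk le_rfl)) (Submodule.smul_mem _ _ hv')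
      · rw [mul_smul]
        exact Submodule.smul_mem _ _ hv'
    · -- base `k + 1 = δ + 1`
      subst heq
      refine ⟨La (δ + 1 + 1 - d (δ + 1)), hLa_unit _, ?_, ?_⟩
      · have h3 := hP3 (δ + 1) hk
        have key : La (δ + 1 + 1 - d (δ + 1)) • ∑ a ∈ A (δ + 1), a • x (d (δ + 1)) =
            ∑ r ∈ R (δ + 1), r • x (δ + 1 + 1) - Lb (δ + 1 + 1 - d (δ + 1)) • w := by
          rw [h3, hw]; abel
        rw [key]
        exact Submodule.sub_mem _ (hz hk le_rfl) (Submodule.smul_mem _ _ (hwmem _))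
      · exact Submodule.smul_mem _ _ (hwmem _)

omit [W.IsElliptic] [W.IsGloballyMinimal] [NeZero (W.conductorNorm ℤ)] hH hβ hpN hap hx hP hdk hR htR in
/-- **The extra point `v_{δ+1}` is `K_δ`-rational**: `τ • v_{δ+1} = v_{δ+1}` for `τ ∈ Gal(K̄/K_δ)` — so its
Kummer classes are killed by `conj_{γ^{p^δ}} − 1`, and the reverse envelope needs only the multiplier
`ω_δ = (1+T)^{p^δ} − 1`. [cite: CastellaGrossiLeeSkinner2022, Rem. 4.1.4 (P[p^{d(k)-1}])] [cite: Howard2004HeegnerKolyvagin, §3.3] -/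
theorem smul_shifted_pred_depth_succ_eq {τ : Field.absoluteGaloisGroup K} (hτ : τ ∈ κ.layerSubgroup δ) :
    τ • ∑ a ∈ A (δ + 1), a • x (d (δ + 1) - 1) = ∑ a ∈ A (δ + 1), a • x (d (δ + 1) - 1) := by
  have hδ : δ < δ + 1 := Nat.lt_succ_self δ
  exact smul_sum_transversal_smul_pred_eq_of_layer_succ hK jbar hfix κ (htwo _ hδ) (hle _ hδ)
    (hmin _ _ hδ (by have := htwo _ hδ; omega)) (hA _) (htA _) hτ

end Packaging

end Literature.NumberTheory.EllipticCurves

end
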